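import Summits.QuantumFields.YangMills.Theorems.IR.EsPolymerDefs

/-!
# Crux `IR` (item stmt-QuantumFields-19354) — line «es-polymer-decoupling», LEAD'S RESHAPE of the misstated engine
stub: the decoupling–polymer representation with clauses (I)(D) at EVERY block radius (`DPRk`)

Helper module for item `stmt-QuantumFields-19354` (`--supports … --as helper`; it closes nothing; lead prover
ym-ir-line-mxc-p1 g2, director-ym R366 pooled the line's engine + rung to this seat).

WHY (evidence `stub-misstated-polymerEngine.md` on the item): the registered engine `PolymerEngine : (∃ p₀) DPRInUnits ⇒
GapInUnits` is not derivable from the format `DPR` of `Theorems/IR/EsPolymerDefs.lean`, whose clauses (I)(D) only see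
observables of the RADIUS-1 blocks of the mesh `b(β) = ⌈ℓ/a β⌉`, while `GapInUnits` fixes `β₂` before the species
`A B : YMSpecies G` of arbitrary (finite) lattice support: at `β` near `β₂` a species spans many blocks and (I)(D) say
nothing about it.  The repair keeps the data of `DPR` (grid, activities, normaliser, sub-measures, (P)) and states
(I)(D) for every block radius `k`, with the owner replaced by the NEAR FAMILY `nearFamily Γ c k` (the polymers of `Γ`
within cell distance `k+1` of `c`; no uniqueness is claimed or needed): (I)_k — block observables of radius `k` about
cells at cell distance `≥ 2k+2` with DISJOINT near families are exactly independent under `ν_Γ`; (D)_k — the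
`ν_Γ`-mean of a radius-`k` block observable is `ν_Γ(1) · Φ (nearFamily Γ c k)`.  Both hold for the Edwards–Sokal
sub-measures of `Theorems/IR/EsPolymerESMeasures.lean` by the same three-block factorisation that proved `stub_esRung`
(rung `ESRungK`, proved in `Theorems/IR/EsPolymerESRungK.lean`); the engine `PolymerEngineK` (provable, L: Kotecký–Preiss
mixing of the hard-core cell gas + the Peierls tail of a polymer near both blocks) and the load `IRPolymerCertK` (XL,
NOT staffed, STRONGER than `IRPolymerCert` and than the crux — it carries the whole price) compose to `BalabanLadder.IR`
BY NAME (`ir_of_polymerK`, real proof).  `DPRk ⇒ DPR` (`dpr_of_dprk`, rung file) records that the reshape refines the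
format.

NOTHING here is asserted: every `def … : Prop` is a line statement that a stub proves or consumes; none is a literature
fact.  HONEST FRAMING: vocabulary for ONE open gap-crux of a CONDITIONAL chain (R4 closes only `BalabanLadder.UV`);
nothing here proves a polymer representation at weak coupling, a lattice mass gap, or the Clay Yang–Mills problem.
-/

set_option autoImplicit false

noncomputable section

open Filter Topology MeasureTheory Finset
open Literature.MathematicalPhysics.QuantumFieldTheory Literature.MathematicalPhysics.QuantumLattice
open Summit.QuantumFields.YangMills.Cruxes.OSLegsFromFemtoAndGap.DlrCollarTransfer (GapInUnits LowerBounds)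

namespace Summit.QuantumFields.YangMills.Cruxes.IR.EsPolymer

/-! ## §1 Near families -/

/-- The polymers of `Γ` NEAR the radius-`k` block about `c`: those with a cell within cell distance `k + 1` of `c`
(at `k = 1` this is the filter whose union is `owner Γ c`). -/
def nearFamily {q : ℕ} (Γ : Finset (Finset (Cell q))) (c : Cell q) (k : ℕ) : Finset (Finset (Cell q)) :=
  Γ.filter fun γ => ∃ c' ∈ γ, cellDist c c' ≤ k + 1

/-- `owner Γ c` is the union of the near family at radius `1`. -/
theorem owner_eq_sup_nearFamily {q : ℕ} (Γ : Finset (Finset (Cell q))) (c : Cell q) :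
    owner Γ c = (nearFamily Γ c 1).sup id := rfl

/-- The near family is a sub-family. -/
theorem nearFamily_subset {q : ℕ} (Γ : Finset (Finset (Cell q))) (c : Cell q) (k : ℕ) : nearFamily Γ c k ⊆ Γ :=
  filter_subset _ _

/-- Membership in the near family. -/
theorem mem_nearFamily {q : ℕ} {Γ : Finset (Finset (Cell q))} {c : Cell q} {k : ℕ} {γ : Finset (Cell q)} :
    γ ∈ nearFamily Γ c k ↔ γ ∈ Γ ∧ ∃ c' ∈ γ, cellDist c c' ≤ k + 1 :=
  mem_filter

/-- A polymer of `Γ` outside the near family has all its cells at cell distance `≥ k + 2` from `c`. -/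
theorem le_cellDist_of_not_mem_nearFamily {q : ℕ} {Γ : Finset (Finset (Cell q))} {c : Cell q} {k : ℕ}
    {γ : Finset (Cell q)} (hγ : γ ∈ Γ) (hn : γ ∉ nearFamily Γ c k) {y : Cell q} (hy : y ∈ γ) :
    k + 2 ≤ cellDist c y := by
  by_contra h
  exact hn (mem_nearFamily.2 ⟨hγ, y, hy, by omega⟩)

/-! ## §2 The representation with clauses at every block radius, and the three statements -/

section Measure

variable {G : Type} [Group G] [TopologicalSpace G] [IsTopologicalGroup G] [CompactSpace G]
  [MeasurableSpace G] [BorelSpace G]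

/-- **`DPRk ρ β S b p` — decoupling–polymer representation at mesh `b` with Peierls parameter `p` and clauses (I)(D) at
EVERY block radius.**  Same data and clauses (P) as `DPR`; (I)_k: under `ν_Γ`, bounded measurable observables of the
radius-`k` blocks about cells `c_A`, `c_B` at cell distance `≥ 2k + 2` whose near families are DISJOINT are exactly
independent; (D)_k: the `ν_Γ`-mean of a radius-`k` block observable is `ν_Γ(1) · Φ (nearFamily Γ c_A k)`. -/
def DPRk {n : ℕ} (ρ : G →* Matrix (Fin n) (Fin n) ℂ) (β : ℝ) (S b : ℕ) (p : ℝ) : Prop :=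
  ∃ (q : ℕ) (w : Fin 4 → ℤ → ℤ), IsGrid (2 * S + 1) b q w ∧
    ∃ (act : Finset (Cell q) → ℝ) (Z : ℝ)
      (ν : Finset (Finset (Cell q)) → Measure (GaugeConfig 4 (2 * S + 1) G)),
      0 < Z ∧ (∀ γ, 0 ≤ act γ ∧ act γ ≤ p ^ γ.card) ∧
      (∀ Γ, ¬ Compatible Γ → ν Γ = 0) ∧
      (Finset.univ.sum ν = wilsonMeasure (d := 4) (L := 2 * S + 1) ρ β) ∧
      (∀ Γ, Compatible Γ → (ν Γ Set.univ).toReal = Z⁻¹ * ∏ γ ∈ Γ, act γ) ∧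
      (∀ Γ, Compatible Γ → ∀ (k : ℕ) (cA cB : Cell q) (A B : GaugeConfig 4 (2 * S + 1) G → ℝ),
          Measurable A → Measurable B → (∃ C, ∀ U, |A U| ≤ C) → (∃ C, ∀ U, |B U| ≤ C) →
          DependsOn A (blockEdges (2 * S + 1) q w cA k) → DependsOn B (blockEdges (2 * S + 1) q w cB k) →
          2 * k + 2 ≤ cellDist cA cB → Disjoint (nearFamily Γ cA k) (nearFamily Γ cB k) →
            (ν Γ Set.univ).toReal * ∫ U, A U * B U ∂(ν Γ) = (∫ U, A U ∂(ν Γ)) * (∫ U, B U ∂(ν Γ))) ∧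
      (∀ (k : ℕ) (cA : Cell q) (A : GaugeConfig 4 (2 * S + 1) G → ℝ), Measurable A → (∃ C, ∀ U, |A U| ≤ C) →
          DependsOn A (blockEdges (2 * S + 1) q w cA k) →
            ∃ Φ : Finset (Finset (Cell q)) → ℝ, ∀ Γ, Compatible Γ →
              ∫ U, A U ∂(ν Γ) = (ν Γ Set.univ).toReal * Φ (nearFamily Γ cA k))

/-- `DPRk` in physical units with Peierls parameter `p`: at some physical mesh `ℓ`, for all large `β` and all large
tori (verbatim the shape of `DPRInUnits`). -/
def DPRkInUnits (r : LatticeRep G) (a : ℝ → ℝ) (p : ℝ) : Prop :=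
  ∃ (ℓ β₂ : ℝ) (S₁ : ℝ → ℕ), 0 < ℓ ∧ ∀ β : ℝ, β₂ ≤ β → ∀ S : ℕ, S₁ β ≤ S → DPRk r.ρ β S ⌈ℓ / a β⌉₊ p

end Measure

/-- **ENGINE, reshaped (provable; abstract Kotecký–Preiss mixing of the hard-core cell gas + clauses (I)_k (D)_k + the
Peierls tail of a polymer near both blocks).**  There is a universal `p₀ > 0` such that `DPRkInUnits r a p₀` gives
`GapInUnits G r a`: a species of lattice support diameter `d` lives in a radius-`k(β)` block with `k(β) ≤ d` bounded
in `β`, so (D)_k reduces its connected correlations to gas covariances of near-family functionals (exponential mixing,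
rate uniform in the regions, prefactor not) plus the shared-near-polymer event (Peierls, diameter `≥` the block gap).
Group-blind, no simplicity. -/
def PolymerEngineK : Prop :=
  ∃ p₀ : ℝ, 0 < p₀ ∧
    ∀ (G : Type) [Group G] [TopologicalSpace G] [IsTopologicalGroup G] [CompactSpace G],
      letI : MeasurableSpace G := borel G; haveI : BorelSpace G := ⟨rfl⟩;
      ∀ (r : LatticeRep G) (a : ℝ → ℝ), (∀ β, 0 < a β) → Tendsto a atTop (𝓝 0) →
        DPRkInUnits r a p₀ → GapInUnits G r a

/-- **THE LOAD, reshaped (XL; NOT staffed; STRONGER than `IRPolymerCert` and than the crux).**  For compact SIMPLE `G`: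
non-triviality in units `a` forces, for EVERY Peierls parameter `p > 0`, a `DPRk` at some physical mesh, eventually in
`β` and on all large tori. -/
def IRPolymerCertK : Prop :=
  ∀ (G : Type) [Group G] [TopologicalSpace G] [IsTopologicalGroup G] [CompactSpace G],
    IsCompactSimpleLieGroup G → letI : MeasurableSpace G := borel G; haveI : BorelSpace G := ⟨rfl⟩;
    ∀ (r : LatticeRep G) (a : ℝ → ℝ), (∀ β, 0 < a β) → Tendsto a atTop (𝓝 0) →
      LowerBounds G r a → ∀ p : ℝ, 0 < p → DPRkInUnits r a p

/-- **RUNG, reshaped (strong coupling, mesh 1, every torus, every block radius).**  For every `p > 0` there is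
`β₀(ρ, p) > 0` with `DPRk ρ β S 1 p` for all `|β| ≤ β₀` and all `S` (Edwards–Sokal deletion; proved in
`Theorems/IR/EsPolymerESRungK.lean`). -/
def ESRungK : Prop :=
  ∀ (G : Type) [Group G] [TopologicalSpace G] [IsTopologicalGroup G] [CompactSpace G]
    [MeasurableSpace G] [BorelSpace G] (n : ℕ) (ρ : G →* Matrix (Fin n) (Fin n) ℂ), Continuous ρ →
    ∀ p : ℝ, 0 < p → ∃ β₀ : ℝ, 0 < β₀ ∧ ∀ β : ℝ, |β| ≤ β₀ → ∀ S : ℕ, DPRk ρ β S 1 p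

/-! ## §3 The composition concluding `BalabanLadder.IR` BY NAME -/

/-- Composition (real proof): reshaped engine + reshaped load ⇒ `IRCal`. -/
theorem irCal_of_polymerK (hE : PolymerEngineK) (hC : IRPolymerCertK) : IRCal := by
  obtain ⟨p₀, hp₀, hE⟩ := hE
  intro G _ _ _ _ hG
  letI : MeasurableSpace G := borel G
  haveI : BorelSpace G := ⟨rfl⟩
  intro r a ha ha0 hlb
  exact hE G r a ha ha0 (hC G hG r a ha ha0 hlb p₀ hp₀)

/-- **Composition (real proof): reshaped engine + reshaped load ⇒ the route decl `BalabanLadder.IR` BY NAME.** -/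
theorem ir_of_polymerK (hE : PolymerEngineK) (hC : IRPolymerCertK) :
    Summit.QuantumFields.YangMills.Theses.BalabanLadder.IR := by
  have h : IRCal := irCal_of_polymerK hE hC
  delta Summit.QuantumFields.YangMills.Theses.BalabanLadder.IR
  delta Summit.QuantumFields.YangMills.Cruxes.IR.EsPolymer.IRCal at h
  exact h

end Summit.QuantumFields.YangMills.Cruxes.IR.EsPolymer

end
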